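import Literature.Geometry.Manifold.KondoTanakaSmoothing
import HarnessLib

/-!
# Kondo–Tanaka smoothing: the differential of the smoothed map stays near the generalised
# Jacobian (the immersion estimate, Kondo–Tanaka Lemmas 2.21–2.25)

Topic `Geometry/Manifold`; namespace `Literature.Geometry.Manifold`. Fourth proof layer under the
named fact `Literature.Geometry.Manifold.KondoTanakaRecognition` (Kondo–Tanaka 2017, Cor. 1.10).
For the patch smoothing `F_ε = Σₚ ρₚ • (J_ε gₚ) ∘ κₚ` of `KondoTanakaSmoothing.lean`
(`gₚ = F ∘ κₚ⁻¹` on `B(0, 3rₚ)`, `gₚ` globally `Lₚ`-Lipschitz) and a point `q₀` in the patch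
`j` (`u₀ = κⱼ q₀ ∈ B(0, 2rⱼ)`):

* `comp_mem_cthickening` — bookkeeping: `A ∈ S_η'`, `‖T − T₀‖ ≤ η''`, `S ∘ T₀ ⊆ J` give
  `A ∘ T ∈ J_{Lη'' + η'‖T‖}`;
* `eventually_fderiv_mollify_transition_mem` — **one patch** (K–T Lemmas 2.22–2.24 in charts):
  for `(ε, u) → (0⁺, u₀)` and `ρₚ(κⱼ⁻¹ u) ≠ 0`,
  `D(J_ε gₚ)(τⱼₚ u) ∘ Dτⱼₚ(u) ∈ ∂gⱼ(u₀)_η` — Lemma 2.10 for `gₚ` at `τⱼₚ u₀`, pulled back by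
  the transition map `τⱼₚ = κₚ ∘ κⱼ⁻¹` with the chain rule `∂gₚ(τ u₀) ∘ Dτ(u₀) ⊆ ∂(gₚ ∘ τ)(u₀)`
  and the locality `gₚ ∘ τ = gⱼ` near `u₀` (K–T: "the notion of the singular point … is
  independent of local charts"; their Jacobi-field / parallel-transport Lemmas 2.19, 2.23 are the
  Riemannian form of the continuity of `Dτ`);
* `eventually_sum_fderiv_mollify_transition_mem` — **K–T Lemma 2.25, first half**: the convex
  combination `Σₚ ρₚ • D(J_ε gₚ)(τ u) ∘ Dτ(u)` lies in the convex set `∂gⱼ(u₀)_η`;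
* `tendsto_patchSmooth_comp_inv` — `F_ε(κⱼ⁻¹ u) → F q₀` as `(ε, u) → (0⁺, u₀)`;
* `eventually_hasFDerivAt_comp_patchSmooth_mem` — **K–T Lemma 2.25 with the target projection
  (proof of Thm. 1.3, "`(dπ_N)_x` is an orthogonal projection … `π_N ∘ F_ε` is an immersion")**:
  for a map `Φ` of class `C¹` near `F q₀` (in the application `Φ = ψ ∘ r`, a chart of `N` after
  the normal retraction), the derivative of `Φ ∘ F_ε ∘ κⱼ⁻¹` at `u` exists and lies in the closed
  `μ`-neighbourhood of `DΦ(F q₀) ∘ ∂gⱼ(u₀)`, for all `(ε, u)` close to `(0⁺, u₀)`.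

Everything here is proved; no definitions, no named facts.

## References

* K. Kondo, M. Tanaka, *Approximations of Lipschitz maps via immersions and differentiable exotic
  sphere theorems*, Nonlinear Anal. 155 (2017) 219–249 (arXiv:1408.6036), Lemmas 2.10, 2.19–2.25
  and the proof of Thm. 1.3 (p. 13). [KondoTanaka2017]
-/

noncomputable section

open scoped Manifold ContDiff Topology NNReal
open Set Function Filter Metric
open Literature.Analysis.Convolution

namespace Literature.Geometry.Manifold

/-! ### Bookkeeping in the space of linear maps -/

section Bookkeeping

variable {X : Type*} [NormedAddCommGroup X] [NormedSpace ℝ X]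
  {Y : Type*} [NormedAddCommGroup Y] [NormedSpace ℝ Y]
  {Z : Type*} [NormedAddCommGroup Z] [NormedSpace ℝ Z]

/-- If `A` is `η'`-close to a compact set `S ⊆ B̄(0, L)` of linear maps, `T` is `η''`-close to `T₀`,
and `S ∘ T₀ ⊆ J`, then `A ∘ T` is `(L η'' + η' ‖T‖)`-close to `J`. [folklore] -/
theorem comp_mem_cthickening {S : Set (Y →L[ℝ] Z)} {J : Set (X →L[ℝ] Z)} (hS : IsCompact S)
    {L : ℝ} (hSL : ∀ B ∈ S, ‖B‖ ≤ L) {T₀ T : X →L[ℝ] Y}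
    (hJ : (fun B : Y →L[ℝ] Z => B.comp T₀) '' S ⊆ J) {A : Y →L[ℝ] Z} {η' η'' : ℝ}
    (hA : A ∈ cthickening η' S) (hη' : 0 ≤ η') (hT : ‖T - T₀‖ ≤ η'') :
    A.comp T ∈ cthickening (L * η'' + η' * ‖T‖) J := by
  rw [hS.cthickening_eq_biUnion_closedBall hη'] at hA
  obtain ⟨B, hB, hAB⟩ := mem_iUnion₂.1 hA
  rw [mem_closedBall, dist_eq_norm] at hAB
  refine mem_cthickening_of_dist_le _ (B.comp T₀) _ _ (hJ ⟨B, hB, rfl⟩) ?_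
  rw [dist_eq_norm]
  have heq : A.comp T - B.comp T₀ = B.comp (T - T₀) + (A - B).comp T := by
    simp only [ContinuousLinearMap.comp_sub, ContinuousLinearMap.sub_comp]; abel
  rw [heq]
  refine (norm_add_le _ _).trans (add_le_add ?_ ?_)
  · exact (ContinuousLinearMap.opNorm_comp_le _ _).trans
      (mul_le_mul (hSL B hB) hT (norm_nonneg _) ((norm_nonneg _).trans (hSL B hB)))
  · exact (ContinuousLinearMap.opNorm_comp_le _ _).trans
      (mul_le_mul_of_nonneg_right hAB (norm_nonneg _))

end Bookkeeping

variable {E : Type*} [NormedAddCommGroup E] [InnerProductSpace ℝ E] [FiniteDimensional ℝ E]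
  [MeasurableSpace E] [BorelSpace E]
  {H : Type*} [TopologicalSpace H] {I : ModelWithCorners ℝ E H}
  {M : Type*} [TopologicalSpace M] [ChartedSpace H M]
  {V : Type*} [NormedAddCommGroup V] [NormedSpace ℝ V] [FiniteDimensional ℝ V]
  [MeasurableSpace V] [BorelSpace V]
  {ι : Type*} [Fintype ι]

namespace PatchSystem

variable (P : PatchSystem I M E ι) [I.Boundaryless] [IsManifold I ∞ M] [T2Space M]

/-! ### One patch: Kondo–Tanaka Lemmas 2.22–2.24 in charts -/

/-- **One patch.** For `(ε, u)` close to `(0⁺, u₀)` (`u₀ = κⱼ q₀`), wherever the weight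
`ρₚ(κⱼ⁻¹ u)` is non-zero, the `p`-th term `D(J_ε gₚ)(τⱼₚ u) ∘ Dτⱼₚ(u)` of the derivative of
`F_ε ∘ κⱼ⁻¹` lies in the closed `η`-neighbourhood of `∂gⱼ(u₀)`.
[cite: KondoTanaka2017, Lemma 2.24] -/
theorem eventually_fderiv_mollify_transition_mem {F : M → V} {g : ι → E → V} {L : ι → ℝ≥0}
    (hg : ∀ p, LipschitzWith (L p) (g p))
    (hgF : ∀ p, EqOn (g p) (F ∘ (P.chart p).inv) (ball 0 (3 * P.r p)))
    {j : ι} {q₀ : M} (hq₀ : q₀ ∈ (P.chart j).source)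
    (hu₀ : (P.chart j).map q₀ ∈ ball (0 : E) (2 * P.r j)) (p : ι) {η : ℝ} (hη : 0 < η) :
    ∀ᶠ pr : ℝ × E in (𝓝[>] (0 : ℝ)) ×ˢ 𝓝 ((P.chart j).map q₀),
      P.rho p ((P.chart j).inv pr.2) ≠ 0 →
        (fderiv ℝ (mollify pr.1 (g p)) ((P.chart j).transition (P.chart p) pr.2)).comp
            (fderiv ℝ ((P.chart j).transition (P.chart p)) pr.2) ∈
          cthickening η (clarkeJacobian (g j) ((P.chart j).map q₀)) := by
  set κ := P.chart j with hκ
  set κ' := P.chart p with hκ'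
  set u₀ : E := κ.map q₀ with hu₀def
  have hinv : κ.inv u₀ = q₀ := κ.inv_map hq₀
  have hu₀t : u₀ ∈ κ.target := κ.map_mem_target hq₀
  have hc : ContinuousAt κ.inv u₀ :=
    κ.continuousOn_inv.continuousAt (κ.isOpen_target.mem_nhds hu₀t)
  have hct : Tendsto κ.inv (𝓝 u₀) (𝓝 q₀) := by
    have h := hc.tendsto; rwa [hinv] at h
  by_cases hgood : q₀ ∈ κ'.source ∧ κ'.map q₀ ∈ closedBall (0 : E) (2 * P.r p)
  swap
  · -- the weight vanishes near `u₀`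
    have h2 : ∀ᶠ u in 𝓝 u₀, P.rho p (κ.inv u) = 0 := hct.eventually (P.rho_eventuallyEq_zero p hgood)
    filter_upwards [h2.prod_inr (𝓝[>] (0 : ℝ))] with pr hpr hne
    exact absurd hpr hne
  obtain ⟨hq₀', hw₀⟩ := hgood
  set τ : E → E := κ.transition κ' with hτdef
  set σ : E → E := κ'.transition κ with hσdef
  have hτu₀ : τ u₀ = κ'.map q₀ := by
    simp only [hτdef, FramedChart.transition_apply, hinv]
  have hO : IsOpen (κ.overlap κ') := κ.isOpen_overlap κ'
  have hu₀O : u₀ ∈ κ.overlap κ' := κ.map_mem_overlap κ' hq₀ hq₀'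
  have hOn : κ.overlap κ' ∈ 𝓝 u₀ := hO.mem_nhds hu₀O
  -- derivative data of the transition map
  have hτcd : ContDiffOn ℝ ∞ τ (κ.overlap κ') := κ.contDiffOn_transition κ'
  have hτd : ∀ᶠ u in 𝓝 u₀, HasFDerivAt τ (fderiv ℝ τ u) u := by
    filter_upwards [hOn] with u hu
    exact ((hτcd.contDiffAt (hO.mem_nhds hu)).differentiableAt (by simp)).hasFDerivAt
  have hτ'c : ContinuousAt (fderiv ℝ τ) u₀ :=
    (hτcd.continuousOn_fderiv_of_isOpen hO (by simp)).continuousAt hOn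
  have hτc : ContinuousAt τ u₀ := (κ.continuousOn_transition κ').continuousAt hOn
  -- the inverse transition map
  have hO' : IsOpen (κ'.overlap κ) := κ'.isOpen_overlap κ
  have hw₀O : τ u₀ ∈ κ'.overlap κ := κ.transition_mem_overlap κ' hu₀O
  have hσc : ContinuousAt σ (τ u₀) := (κ'.continuousOn_transition κ).continuousAt (hO'.mem_nhds hw₀O)
  have hστ : σ (τ u₀) = u₀ := κ.transition_transition κ' hu₀O
  have hτσ : ∀ᶠ z in 𝓝 (τ u₀), τ (σ z) = z := by
    filter_upwards [hO'.mem_nhds hw₀O] with z hz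
    exact κ'.transition_transition κ hz
  -- locality: `gₚ ∘ τ = gⱼ` near `u₀`
  have hloc : (g p) ∘ τ =ᶠ[𝓝 u₀] g j := by
    have h3 : ∀ᶠ u in 𝓝 u₀, τ u ∈ ball (0 : E) (3 * P.r p) := by
      refine hτc.preimage_mem_nhds (isOpen_ball.mem_nhds ?_)
      rw [hτu₀]
      exact closedBall_subset_ball (by nlinarith [P.r_pos p]) hw₀
    have h4 : ∀ᶠ u in 𝓝 u₀, u ∈ ball (0 : E) (3 * P.r j) :=
      isOpen_ball.mem_nhds (ball_subset_ball (by nlinarith [P.r_pos j]) hu₀)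
    filter_upwards [hOn, h3, h4] with u huO hu3 hu4
    obtain ⟨-, hus⟩ := (κ.mem_overlap_iff κ').1 huO
    simp only [comp_apply]
    rw [hgF p hu3, hgF j hu4]
    simp only [comp_apply, hτdef, FramedChart.transition_apply]
    exact congrArg F (κ'.inv_map hus)
  have hchain : (fun A : E →L[ℝ] V => A.comp (fderiv ℝ τ u₀)) '' clarkeJacobian (g p) (τ u₀) ⊆
      clarkeJacobian (g j) u₀ := by
    rw [← clarkeJacobian_congr hloc]
    exact image_clarkeJacobian_comp_right_subset hτd hτ'c hσc hστ hτσ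
  -- constants
  set T₀ : ℝ := ‖fderiv ℝ τ u₀‖ with hT₀
  set η₁ : ℝ := η / (2 * (T₀ + 2)) with hη₁def
  set η₂ : ℝ := η / (2 * ((L p : ℝ) + 1)) with hη₂def
  have hη₁ : 0 < η₁ := by positivity
  have hη₂ : 0 < η₂ := by positivity
  -- (i) the mollified derivative of `gₚ` near `∂gₚ(τ u₀)`, pulled back along `τ`
  have hB := eventually_fderiv_mollify_mem_cthickening (hg p) (τ u₀) hη₁
  have hpull : Tendsto (fun pr : ℝ × E => (pr.1, τ pr.2)) ((𝓝[>] (0 : ℝ)) ×ˢ 𝓝 u₀)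
      ((𝓝[>] (0 : ℝ)) ×ˢ 𝓝 (τ u₀)) :=
    tendsto_fst.prodMk (hτc.tendsto.comp tendsto_snd)
  have h1 := hpull.eventually hB
  -- (ii) `Dτ(u)` close to `Dτ(u₀)`
  have h2 : ∀ᶠ u in 𝓝 u₀, ‖fderiv ℝ τ u - fderiv ℝ τ u₀‖ ≤ η₂ ∧ ‖fderiv ℝ τ u‖ ≤ T₀ + 1 := by
    have hm : closedBall (fderiv ℝ τ u₀) (min η₂ 1) ∈ 𝓝 (fderiv ℝ τ u₀) :=
      closedBall_mem_nhds _ (lt_min hη₂ one_pos)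
    filter_upwards [hτ'c.preimage_mem_nhds hm] with u hu
    rw [mem_preimage, mem_closedBall, dist_eq_norm] at hu
    exact ⟨hu.trans (min_le_left _ _),
      (norm_le_norm_add_norm_sub' (fderiv ℝ τ u) (fderiv ℝ τ u₀)).trans
        (by linarith [hu.trans (min_le_right η₂ 1)])⟩
  filter_upwards [h1, h2.prod_inr (𝓝[>] (0 : ℝ))] with pr hpr1 hpr2 _
  obtain ⟨hd2, hT⟩ := hpr2
  have hSL : ∀ B ∈ clarkeJacobian (g p) (τ u₀), ‖B‖ ≤ L p := fun B hB =>
    norm_le_of_mem_clarkeJacobian univ_mem (lipschitzOnWith_univ.2 (hg p)) hB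
  have key := comp_mem_cthickening
    (isCompact_clarkeJacobian univ_mem (lipschitzOnWith_univ.2 (hg p))) hSL hchain hpr1 hη₁.le hd2
  refine cthickening_mono ?_ _ key
  have hLp : (0 : ℝ) ≤ L p := (L p).coe_nonneg
  have hT₀0 : 0 ≤ T₀ := norm_nonneg _
  have hA1 : (L p : ℝ) * η₂ ≤ η / 2 := by
    rw [hη₂def, mul_div_assoc', div_le_div_iff₀ (by positivity) two_pos]
    nlinarith
  have hA2 : η₁ * ‖fderiv ℝ τ pr.2‖ ≤ η / 2 := by
    refine (mul_le_mul_of_nonneg_left hT hη₁.le).trans ?_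
    rw [hη₁def, div_mul_eq_mul_div, div_le_div_iff₀ (by positivity) two_pos]
    nlinarith
  linarith

/-! ### The convex combination: Kondo–Tanaka Lemma 2.25, first half -/

/-- **All patches** (K–T Lemma 2.25, (2.21)): for `(ε, u)` close to `(0⁺, u₀)` the convex
combination `Σₚ ρₚ(κⱼ⁻¹ u) • D(J_ε gₚ)(τⱼₚ u) ∘ Dτⱼₚ(u)` lies in the closed `η`-neighbourhood of
`∂gⱼ(u₀)` (a convex set). [cite: KondoTanaka2017, Lemma 2.25] -/
theorem eventually_sum_fderiv_mollify_transition_mem {F : M → V} {g : ι → E → V} {L : ι → ℝ≥0}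
    (hg : ∀ p, LipschitzWith (L p) (g p))
    (hgF : ∀ p, EqOn (g p) (F ∘ (P.chart p).inv) (ball 0 (3 * P.r p)))
    {j : ι} {q₀ : M} (hq₀ : q₀ ∈ (P.chart j).source)
    (hu₀ : (P.chart j).map q₀ ∈ ball (0 : E) (2 * P.r j)) {η : ℝ} (hη : 0 < η) :
    ∀ᶠ pr : ℝ × E in (𝓝[>] (0 : ℝ)) ×ˢ 𝓝 ((P.chart j).map q₀),
      (∑ p, P.rho p ((P.chart j).inv pr.2) •
          (fderiv ℝ (mollify pr.1 (g p)) ((P.chart j).transition (P.chart p) pr.2)).comp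
            (fderiv ℝ ((P.chart j).transition (P.chart p)) pr.2)) ∈
        cthickening η (clarkeJacobian (g j) ((P.chart j).map q₀)) := by
  classical
  have hall := eventually_all.2 fun p =>
    P.eventually_fderiv_mollify_transition_mem hg hgF hq₀ hu₀ p hη
  filter_upwards [hall] with pr hpr
  set x : M := (P.chart j).inv pr.2 with hx
  set T : ι → E →L[ℝ] V := fun p =>
    (fderiv ℝ (mollify pr.1 (g p)) ((P.chart j).transition (P.chart p) pr.2)).comp
      (fderiv ℝ ((P.chart j).transition (P.chart p)) pr.2) with hT
  have hC : Convex ℝ (cthickening η (clarkeJacobian (g j) ((P.chart j).map q₀))) :=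
    (convex_clarkeJacobian (f := g j) (x := (P.chart j).map q₀)).cthickening η
  change ∑ p, P.rho p x • T p ∈ _
  rw [← Finset.sum_filter_of_ne (s := Finset.univ) (p := fun q => P.rho q x ≠ 0)
    (fun q _ h hq => h (by rw [hq, zero_smul]))]
  refine hC.sum_mem (fun q _ => P.rho_nonneg q x) ?_ fun q hq => hpr q (Finset.mem_filter.1 hq).2
  rw [Finset.sum_filter_ne_zero, P.sum_rho]

/-! ### Convergence of the smoothed map read in a chart -/

omit [MeasurableSpace V] [BorelSpace V] [I.Boundaryless] [IsManifold I ∞ M] [T2Space M] in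
/-- `F_ε(κⱼ⁻¹ u) → F q₀` as `(ε, u) → (0⁺, κⱼ q₀)` (Lemma 2.17 and continuity of `gⱼ`).
[cite: KondoTanaka2017, Lemma 2.17] -/
theorem tendsto_patchSmooth_comp_inv {F : M → V} {g : ι → E → V} {L : ι → ℝ≥0}
    (hg : ∀ p, LipschitzWith (L p) (g p))
    (hgF : ∀ p, EqOn (g p) (F ∘ (P.chart p).inv) (ball 0 (3 * P.r p)))
    {j : ι} {q₀ : M} (hq₀ : q₀ ∈ (P.chart j).source)
    (hu₀ : (P.chart j).map q₀ ∈ ball (0 : E) (2 * P.r j)) :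
    Tendsto (fun pr : ℝ × E => ∑ p, P.rho p ((P.chart j).inv pr.2) •
        mollify pr.1 (g p) ((P.chart p).map ((P.chart j).inv pr.2)))
      ((𝓝[>] (0 : ℝ)) ×ˢ 𝓝 ((P.chart j).map q₀)) (𝓝 (F q₀)) := by
  set κ := P.chart j with hκ
  set u₀ : E := κ.map q₀ with hu₀def
  set S : ℝ × E → V := fun pr => ∑ p, P.rho p (κ.inv pr.2) •
    mollify pr.1 (g p) ((P.chart p).map (κ.inv pr.2)) with hS
  have hgj0 : g j u₀ = F q₀ := by
    rw [hgF j (ball_subset_ball (by nlinarith [P.r_pos j]) hu₀), comp_apply, κ.inv_map hq₀]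
  -- the comparison map `gⱼ ∘ snd` tends to `F q₀`
  have hG : Tendsto (fun pr : ℝ × E => g j pr.2) ((𝓝[>] (0 : ℝ)) ×ˢ 𝓝 u₀) (𝓝 (F q₀)) := by
    rw [← hgj0]
    exact ((hg j).continuous.tendsto u₀).comp tendsto_snd
  -- the difference tends to `0`
  have hε0 : Tendsto (fun pr : ℝ × E => pr.1) ((𝓝[>] (0 : ℝ)) ×ˢ 𝓝 u₀) (𝓝 0) :=
    tendsto_fst.mono_right nhdsWithin_le_nhds
  have hdiff : Tendsto (fun pr : ℝ × E => S pr - g j pr.2) ((𝓝[>] (0 : ℝ)) ×ˢ 𝓝 u₀) (𝓝 0) := by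
    have hbound : ∀ᶠ pr : ℝ × E in (𝓝[>] (0 : ℝ)) ×ˢ 𝓝 u₀,
        ‖S pr - g j pr.2‖ ≤ (∑ p, (L p : ℝ)) * (2 * pr.1) := by
      have hpos : ∀ᶠ ε in 𝓝[>] (0 : ℝ), 0 < ε := eventually_mem_nhdsWithin
      have hball : ∀ᶠ u in 𝓝 u₀, u ∈ ball (0 : E) (3 * P.r j) :=
        isOpen_ball.mem_nhds (ball_subset_ball (by nlinarith [P.r_pos j]) hu₀)
      filter_upwards [hpos.prod_inl (𝓝 u₀), hball.prod_inr (𝓝[>] (0 : ℝ))] with pr hpr hu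
      have hgu : g j pr.2 = F (κ.inv pr.2) := hgF j hu
      rw [hgu]
      exact P.norm_patchSmooth_sub_le hg hgF hpr (κ.inv pr.2)
    refine squeeze_zero_norm' hbound ?_
    simpa using (hε0.const_mul (2 : ℝ)).const_mul (∑ p, (L p : ℝ))
  have h := hdiff.add hG
  simp only [zero_add, sub_add_cancel] at h
  exact h

/-! ### The target side: Kondo–Tanaka Lemma 2.25 with the projection -/

/-- **The differential of `Φ ∘ F_ε` in the chart `κⱼ` stays near `DΦ(F q₀) ∘ ∂gⱼ(u₀)`**
(K–T Lemma 2.25 and the end of the proof of Thm. 1.3: with `Φ = ψ ∘ π_N` a chart of `N` after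
the nearest-point retraction, `D(ψ ∘ π_N ∘ F_ε ∘ κⱼ⁻¹)(u)` is, up to `μ`, of the form
`DΦ(F q₀) ∘ A` with `A ∈ ∂gⱼ(u₀)`; there every such map is of maximal rank). For `Φ` of class
`C¹` near `F q₀` (derivative `Φ'`, continuous at `F q₀`) and `μ > 0`: for all `(ε, u)` close to
`(0⁺, u₀)` the derivative `D` of `Φ ∘ F_ε ∘ κⱼ⁻¹` at `u` exists and
`D ∈ (DΦ(F q₀) ∘ ∂gⱼ(u₀))_μ`. [cite: KondoTanaka2017, Lemma 2.25] -/
theorem eventually_hasFDerivAt_comp_patchSmooth_mem {F : M → V} {g : ι → E → V} {L : ι → ℝ≥0}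
    (hg : ∀ p, LipschitzWith (L p) (g p))
    (hgF : ∀ p, EqOn (g p) (F ∘ (P.chart p).inv) (ball 0 (3 * P.r p)))
    {j : ι} {q₀ : M} (hq₀ : q₀ ∈ (P.chart j).source)
    (hu₀ : (P.chart j).map q₀ ∈ ball (0 : E) (2 * P.r j))
    {W : Type*} [NormedAddCommGroup W] [NormedSpace ℝ W] {Φ : V → W} {Φ' : V → V →L[ℝ] W}
    (hΦ : ∀ᶠ y in 𝓝 (F q₀), HasFDerivAt Φ (Φ' y) y) (hΦ' : ContinuousAt Φ' (F q₀))
    {μ : ℝ} (hμ : 0 < μ) :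
    ∀ᶠ pr : ℝ × E in (𝓝[>] (0 : ℝ)) ×ˢ 𝓝 ((P.chart j).map q₀),
      ∃ D : E →L[ℝ] W,
        HasFDerivAt (Φ ∘ (fun x => ∑ p, P.rho p x • mollify pr.1 (g p) ((P.chart p).map x)) ∘
            (P.chart j).inv) D pr.2 ∧
          D ∈ cthickening μ ((fun A : E →L[ℝ] V => (Φ' (F q₀)).comp A) ''
            clarkeJacobian (g j) ((P.chart j).map q₀)) := by
  set κ := P.chart j with hκ
  set u₀ : E := κ.map q₀ with hu₀def
  set P₀ : V →L[ℝ] W := Φ' (F q₀) with hP₀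
  obtain ⟨C, hC0, hCd⟩ := P.exists_hasFDerivAt_patchSmooth_comp_inv hg hgF j
  -- constants
  set Lj : ℝ := (L j : ℝ) with hLj
  have hLj0 : 0 ≤ Lj := (L j).coe_nonneg
  set η : ℝ := μ / (3 * (‖P₀‖ + 1)) with hηdef
  have hη : 0 < η := by positivity
  set θ : ℝ := μ / (3 * (Lj + 2 * η + 1)) with hθdef
  have hθ : 0 < θ := by positivity
  -- eventual facts
  have e1 : ∀ᶠ pr : ℝ × E in (𝓝[>] (0 : ℝ)) ×ˢ 𝓝 u₀, 0 < pr.1 ∧ C * pr.1 ≤ η := by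
    have h : ∀ᶠ ε in 𝓝[>] (0 : ℝ), 0 < ε ∧ C * ε ≤ η := by
      have hlt : ∀ᶠ ε in 𝓝[>] (0 : ℝ), ε < η / (C + 1) :=
        mem_nhdsWithin_of_mem_nhds (Iio_mem_nhds (by positivity))
      filter_upwards [eventually_mem_nhdsWithin, hlt] with ε hε hεlt
      refine ⟨hε, ?_⟩
      have h1 : C * ε ≤ C * (η / (C + 1)) := mul_le_mul_of_nonneg_left hεlt.le hC0
      have h2 : C * (η / (C + 1)) ≤ η := by
        rw [mul_div_assoc', div_le_iff₀ (by positivity)]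
        nlinarith
      exact h1.trans h2
    exact h.prod_inl (𝓝 u₀)
  have e2 : ∀ᶠ pr : ℝ × E in (𝓝[>] (0 : ℝ)) ×ˢ 𝓝 u₀, pr.2 ∈ closedBall (0 : E) (3 * P.r j) := by
    have h : closedBall (0 : E) (3 * P.r j) ∈ 𝓝 u₀ :=
      mem_of_superset (isOpen_ball.mem_nhds (ball_subset_ball (by nlinarith [P.r_pos j]) hu₀))
        ball_subset_closedBall
    exact (eventually_mem_set.2 h |>.prod_inr (𝓝[>] (0 : ℝ)) :)
  have e3 := P.eventually_sum_fderiv_mollify_transition_mem hg hgF hq₀ hu₀ hη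
  have e4 : ∀ᶠ pr : ℝ × E in (𝓝[>] (0 : ℝ)) ×ˢ 𝓝 u₀,
      HasFDerivAt Φ (Φ' (∑ p, P.rho p (κ.inv pr.2) • mollify pr.1 (g p) ((P.chart p).map (κ.inv pr.2))))
          (∑ p, P.rho p (κ.inv pr.2) • mollify pr.1 (g p) ((P.chart p).map (κ.inv pr.2))) ∧
        ‖Φ' (∑ p, P.rho p (κ.inv pr.2) • mollify pr.1 (g p) ((P.chart p).map (κ.inv pr.2))) - P₀‖
          ≤ θ := by
    have ht := P.tendsto_patchSmooth_comp_inv hg hgF hq₀ hu₀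
    have hnear : ∀ᶠ y in 𝓝 (F q₀), ‖Φ' y - P₀‖ ≤ θ := by
      have h := hΦ'.tendsto.eventually (eventually_mem_set.2 (closedBall_mem_nhds P₀ hθ))
      filter_upwards [h] with y hy
      rwa [mem_closedBall, dist_eq_norm] at hy
    exact ht.eventually (hΦ.and hnear)
  filter_upwards [e1, e2, e3, e4] with pr hpr1 hu hBmem hpr4
  obtain ⟨hε, hCε⟩ := hpr1
  obtain ⟨hΦd, hΦc⟩ := hpr4
  obtain ⟨A, hA, hderiv⟩ := hCd pr.1 hε pr.2 hu
  set B : E →L[ℝ] V := ∑ p, P.rho p (κ.inv pr.2) •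
    (fderiv ℝ (mollify pr.1 (g p)) (κ.transition (P.chart p) pr.2)).comp
      (fderiv ℝ (κ.transition (P.chart p)) pr.2) with hBdef
  set Q : V →L[ℝ] W :=
    Φ' (∑ p, P.rho p (κ.inv pr.2) • mollify pr.1 (g p) ((P.chart p).map (κ.inv pr.2))) with hQ
  refine ⟨Q.comp (A + B), hΦd.comp pr.2 hderiv, ?_⟩
  -- decompose `B = B₀ + (B - B₀)` with `B₀ ∈ ∂gⱼ(u₀)`
  have hJc : IsCompact (clarkeJacobian (g j) u₀) :=
    isCompact_clarkeJacobian univ_mem (lipschitzOnWith_univ.2 (hg j))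
  rw [hJc.cthickening_eq_biUnion_closedBall hη.le] at hBmem
  obtain ⟨B₀, hB₀, hBB₀⟩ := mem_iUnion₂.1 hBmem
  rw [mem_closedBall, dist_eq_norm] at hBB₀
  have hB₀n : ‖B₀‖ ≤ Lj := norm_le_of_mem_clarkeJacobian univ_mem (lipschitzOnWith_univ.2 (hg j)) hB₀
  refine mem_cthickening_of_dist_le _ (P₀.comp B₀) _ _ ⟨B₀, hB₀, rfl⟩ ?_
  rw [dist_eq_norm]
  have heq : Q.comp (A + B) - P₀.comp B₀ =
      P₀.comp (B - B₀) + P₀.comp A + (Q - P₀).comp (A + B) := by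
    simp only [ContinuousLinearMap.comp_add, ContinuousLinearMap.comp_sub,
      ContinuousLinearMap.sub_comp]
    abel
  rw [heq]
  have hAn : ‖A‖ ≤ η := hA.trans hCε
  have hBn : ‖B‖ ≤ Lj + η := by
    have h := norm_le_norm_add_norm_sub' B B₀
    linarith
  have t1 : ‖P₀.comp (B - B₀)‖ ≤ ‖P₀‖ * η :=
    (ContinuousLinearMap.opNorm_comp_le _ _).trans (mul_le_mul_of_nonneg_left hBB₀ (norm_nonneg _))
  have t2 : ‖P₀.comp A‖ ≤ ‖P₀‖ * η :=
    (ContinuousLinearMap.opNorm_comp_le _ _).trans (mul_le_mul_of_nonneg_left hAn (norm_nonneg _))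
  have t3 : ‖(Q - P₀).comp (A + B)‖ ≤ θ * (Lj + 2 * η) := by
    refine (ContinuousLinearMap.opNorm_comp_le _ _).trans (mul_le_mul hΦc ?_ (norm_nonneg _) hθ.le)
    exact (norm_add_le _ _).trans (by linarith)
  have s1 : ‖P₀‖ * η ≤ μ / 3 := by
    rw [hηdef, mul_div_assoc', div_le_div_iff₀ (by positivity) three_pos]
    nlinarith [norm_nonneg P₀]
  have s3 : θ * (Lj + 2 * η) ≤ μ / 3 := by
    rw [hθdef, div_mul_eq_mul_div, div_le_div_iff₀ (by positivity) three_pos]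
    nlinarith [hη.le]
  calc ‖P₀.comp (B - B₀) + P₀.comp A + (Q - P₀).comp (A + B)‖
      ≤ ‖P₀.comp (B - B₀)‖ + ‖P₀.comp A‖ + ‖(Q - P₀).comp (A + B)‖ := norm_add₃_le
    _ ≤ μ / 3 + μ / 3 + μ / 3 := by linarith
    _ = μ := by ring

end PatchSystem

end Literature.Geometry.Manifold

end
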